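import Literature.NumberTheory.EllipticCurves.HeckeTnGamma0
import Literature.NumberTheory.EllipticCurves.HeckeOperatorsGamma0Proofs
import Literature.NumberTheory.EllipticCurves.ModularSymbolsProofs
import Literature.NumberTheory.Automorphic.PopaZagierHeckeCompatibility
import Mathlib.Data.Nat.Factorization.Induction
import HarnessLib

/-!
# `T_n` on `S_k(Γ₀(N))`, `(n, N) = 1`, as the explicit sum over upper-triangular representatives,
# and the modular symbols of `T_n f`

Theorems and definitions with bodies only (D-0026). The tree defines `T_n = heckeTnGamma0 N k n`
on `S_k(Γ₀(N))` by transport of Diamond–Shurman's recursive definition on `S_k(Γ₁(N))`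
(`T_{p^{r+2}} = T_p T_{p^{r+1}} - p^{k-1} T_{p^r}`, `T_{mn} = T_m T_n`), and knows
`T_p f = ∑_{j mod p} f|(1 j; 0 p) + f|diag(p, 1)` for `p ∤ N` (`coe_heckeT_gamma0_eq_sum`,
Diamond–Shurman Prop. 5.2.1). This file proves the classical explicit formula for all `n` prime
to `N` (Diamond–Shurman Prop. 5.3.1 / Shimura Prop. 3.36 in the form of (3.5.9)):

* `coe_heckeTnGamma0_eq_opU` / `coe_heckeTnGamma0_eq_sum_slash` —
  `(T_n f)(τ) = ∑_{ad = n, 0 ≤ b < d} (f |_k (a b; 0 d))(τ) = ∑_{ad=n} a^{k-1} d⁻¹ ∑_b f((aτ+b)/d)`;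
* `modularSymbol_heckeTnGamma0` — `{∞, r}_{T_n f} = ∑_{ad = n, 0 ≤ b < d} {∞, (ar + b)/d}_f`
  (Cremona 1997, (2.4.1)–(2.4.2); Merel 1994, §2).

**Proof.** On `1`-periodic functions `G : ℂ → ℂ` put `(V_a G)(z) = G(az)`,
`(Π_d G)(z) = d⁻¹ ∑_{b mod d} G((z + b)/d)` and `U_n = ∑_{ad=n} a^{k-1} V_a Π_d`. Then
`Π_d Π_{d'} = Π_{dd'}`, `Π_p V_p = 1`, `Π_d V_a = V_a Π_d` for `(a, d) = 1`, whence
`U_m U_n = U_{mn}` for `(m, n) = 1` and `U_p U_{p^{r+1}} = U_{p^{r+2}} + p^{k-1} U_{p^r}`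
(the elementary proof of Diamond–Shurman Prop. 5.2.4/5.3.1 without `q`-expansions); since
`T_p = U_p` on `S_k(Γ₀(N))` for `p ∤ N` and `T_n` satisfies the same recursions, `T_n = U_n` by
induction over the prime factorisation.

## References

* [DiamondShurman2005] F. Diamond, J. Shurman, GTM 228, Prop. 5.2.1, Prop. 5.2.4, §5.3
  (Prop. 5.3.1).
* G. Shimura, *Introduction to the arithmetic theory of automorphic functions*, 1971, Prop. 3.36,
  (3.5.9)–(3.5.10).
* [CremonaAlgorithms1997] J. E. Cremona, *Algorithms for modular elliptic curves*, §2.4.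
-/

noncomputable section

open scoped MatrixGroups ModularForm

open Complex Function CongruenceSubgroup
open UpperHalfPlane hiding I

namespace Literature.NumberTheory.EllipticCurves.ModularForms

/-! ### The operators `V_a`, `Π_d`, `U_n` on `1`-periodic functions `ℂ → ℂ` -/

namespace UpperHecke

/-- `(V_a G)(z) = G(a z)`. [folklore] -/
def opV (a : ℕ) (G : ℂ → ℂ) : ℂ → ℂ := fun z => G (a * z)

/-- `(Π_d G)(z) = d⁻¹ ∑_{b=0}^{d-1} G((z + b)/d)`. [folklore] -/
def opP (d : ℕ) (G : ℂ → ℂ) : ℂ → ℂ := fun z => (d : ℂ)⁻¹ * ∑ b ∈ Finset.range d, G ((z + b) / d)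

/-- `U_n^{(k)} = ∑_{ad = n} a^{k-1} V_a Π_d`, i.e.
`(U_n G)(z) = ∑_{ad=n} a^{k-1} d⁻¹ ∑_{b mod d} G((az + b)/d) = ∑_{ad=n, b mod d} (G|_k (a b; 0 d))(z)`.
[cite: DiamondShurman2005, Prop. 5.3.1] -/
def opU (k : ℤ) (n : ℕ) (G : ℂ → ℂ) : ℂ → ℂ :=
  fun z => ∑ x ∈ n.divisorsAntidiagonal, (x.1 : ℂ) ^ (k - 1) * opV x.1 (opP x.2 G) z

variable {G : ℂ → ℂ}

/-- `V_a` preserves `1`-periodicity. [folklore] -/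
theorem periodic_opV (hG : Periodic G 1) (a : ℕ) : Periodic (opV a G) 1 := by
  intro z
  simp only [opV, mul_add, mul_one]
  simpa using hG.nat_mul a (a * z)

/-- `Π_d` preserves `1`-periodicity (`d > 0`). [folklore] -/
theorem periodic_opP (hG : Periodic G 1) {d : ℕ} (hd : 0 < d) : Periodic (opP d G) 1 := by
  intro z
  simp only [opP]
  congr 1
  have hd' : (d : ℂ) ≠ 0 := by exact_mod_cast hd.ne'
  set g : ℕ → ℂ := fun c => G ((z + c) / d) with hg
  have h1 : ∀ b : ℕ, G ((z + 1 + (b : ℂ)) / d) = g (b + 1) := by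
    intro b; simp only [hg, Nat.cast_add, Nat.cast_one]; congr 1; ring
  simp_rw [h1]
  have hper : g d = g 0 := by
    simp only [hg, Nat.cast_zero, add_zero]
    rw [show (z + (d : ℂ)) / d = z / d + 1 by field_simp]
    exact hG _
  have h3 : ∑ b ∈ Finset.range d, g (b + 1) + g 0 = ∑ b ∈ Finset.range d, g b + g d :=
    (Finset.sum_range_succ' g d).symm.trans (Finset.sum_range_succ g d)
  rw [hper] at h3
  exact add_right_cancel h3

/-- `V_1 = 1`. [folklore] -/
@[simp] theorem opV_one (G : ℂ → ℂ) : opV 1 G = G := by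
  funext z; simp [opV]

/-- `Π_1 = 1`. [folklore] -/
@[simp] theorem opP_one (G : ℂ → ℂ) : opP 1 G = G := by
  funext z; simp [opP]

/-- `V_a V_{a'} = V_{a a'}`. [folklore] -/
theorem opV_opV (a a' : ℕ) (G : ℂ → ℂ) : opV a (opV a' G) = opV (a * a') G := by
  funext z; simp only [opV, Nat.cast_mul]; ring_nf

/-- `Π_d` is additive. [folklore] -/
theorem opP_add (d : ℕ) (G H : ℂ → ℂ) : opP d (G + H) = opP d G + opP d H := by
  funext z; simp only [opP, Pi.add_apply, Finset.sum_add_distrib, mul_add]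

/-- `Π_d` commutes with scalars. [folklore] -/
theorem opP_smul (d : ℕ) (c : ℂ) (G : ℂ → ℂ) : opP d (c • G) = c • opP d G := by
  funext z; simp only [opP, Pi.smul_apply, smul_eq_mul, Finset.mul_sum];
  congr 1; ext; ring

/-- `Π_d` commutes with finite sums. [folklore] -/
theorem opP_sum {ι : Type*} (s : Finset ι) (d : ℕ) (G : ι → ℂ → ℂ) :
    opP d (fun z => ∑ i ∈ s, G i z) = fun z => ∑ i ∈ s, opP d (G i) z := by
  funext z
  simp only [opP, Finset.mul_sum]
  rw [Finset.sum_comm]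

/-- `V_a` commutes with finite sums. [folklore] -/
theorem opV_sum {ι : Type*} (s : Finset ι) (a : ℕ) (G : ι → ℂ → ℂ) :
    opV a (fun z => ∑ i ∈ s, G i z) = fun z => ∑ i ∈ s, opV a (G i) z := by
  funext z; simp [opV]

/-- `V_a (c G) = c V_a G`. [folklore] -/
theorem opV_const_mul (a : ℕ) (c : ℂ) (G : ℂ → ℂ) :
    opV a (fun z => c * G z) = fun z => c * opV a G z := by
  funext z; simp [opV]

/-- `Π_d (c G) = c Π_d G`. [folklore] -/
theorem opP_const_mul (d : ℕ) (c : ℂ) (G : ℂ → ℂ) :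
    opP d (fun z => c * G z) = fun z => c * opP d G z := by
  funext z; simp only [opP, Finset.mul_sum]; exact Finset.sum_congr rfl fun _ _ => by ring

/-- Reindexing `c = b + d b'` (`b < d`, `b' < d'`) of a sum over `c < d d'`. [folklore] -/
theorem sum_range_mul_eq {M : Type*} [AddCommMonoid M] (H : ℕ → M) (d d' : ℕ) :
    ∑ c ∈ Finset.range (d * d'), H c = ∑ b ∈ Finset.range d, ∑ b' ∈ Finset.range d', H (b + d * b') := by
  rw [Finset.sum_range, show d * d' = d' * d from mul_comm _ _,
    ← Equiv.sum_comp finProdFinEquiv (fun c : Fin (d' * d) => H c), Fintype.sum_prod_type,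
    Finset.sum_comm, Finset.sum_range]
  refine Finset.sum_congr rfl fun j _ => ?_
  rw [Finset.sum_range]
  refine Finset.sum_congr rfl fun i _ => ?_
  simp [finProdFinEquiv]

/-- **`Π_d Π_{d'} = Π_{d d'}`** (the digits `b + d b'`, `b < d`, `b' < d'`, run over the residues
mod `d d'`). [folklore] -/
theorem opP_opP {d d' : ℕ} (hd : 0 < d) (hd' : 0 < d') (G : ℂ → ℂ) :
    opP d (opP d' G) = opP (d * d') G := by
  funext z
  have hdc : (d : ℂ) ≠ 0 := by exact_mod_cast hd.ne'
  have hdc' : (d' : ℂ) ≠ 0 := by exact_mod_cast hd'.ne'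
  simp only [opP]
  rw [sum_range_mul_eq (fun c : ℕ => G ((z + (c : ℂ)) / ((d * d' : ℕ) : ℂ))) d d']
  simp only [Finset.mul_sum]
  refine Finset.sum_congr rfl fun b _ => Finset.sum_congr rfl fun b' _ => ?_
  rw [← mul_assoc]
  congr 1
  · push_cast; rw [mul_inv]
  · congr 1; push_cast; field_simp; ring

/-- **`Π_p V_p = 1`** on `1`-periodic functions (`p > 0`). [folklore] -/
theorem opP_opV_self (hG : Periodic G 1) {p : ℕ} (hp : 0 < p) : opP p (opV p G) = G := by
  funext z
  simp only [opP, opV]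
  have hpc : (p : ℂ) ≠ 0 := by exact_mod_cast hp.ne'
  have h : ∀ b ∈ Finset.range p, G ((p : ℂ) * ((z + b) / p)) = G z := by
    intro b _
    rw [mul_div_cancel₀ _ hpc]
    simpa using hG.nat_mul b z
  rw [Finset.sum_congr rfl h, Finset.sum_const, Finset.card_range, nsmul_eq_mul, ← mul_assoc,
    inv_mul_cancel₀ hpc, one_mul]

/-- Multiplication by `a` permutes the residues mod `d` when `(a, d) = 1`. [folklore] -/
theorem image_mul_mod_range {a d : ℕ} (had : Nat.Coprime a d) :
    (Finset.range d).image (fun b => a * b % d) = Finset.range d := by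
  rcases Nat.eq_zero_or_pos d with rfl | hd
  · simp
  have hinj : Set.InjOn (fun b : ℕ => a * b % d) (Finset.range d) := by
    intro b hb b' hb' h
    simp only [Finset.coe_range, Set.mem_Iio] at hb hb'
    have hmod : a * b ≡ a * b' [MOD d] := h
    exact (Nat.ModEq.cancel_left_of_coprime (by simpa [Nat.Coprime, Nat.gcd_comm] using had) hmod)
      |>.eq_of_lt_of_lt hb hb'
  refine Finset.eq_of_subset_of_card_le (fun c hc => ?_) ?_
  · simp only [Finset.mem_image, Finset.mem_range] at hc ⊢
    obtain ⟨b, -, rfl⟩ := hc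
    exact Nat.mod_lt _ hd
  · rw [Finset.card_image_of_injOn hinj]

/-- **`Π_d V_a = V_a Π_d` for `(a, d) = 1`** on `1`-periodic functions: `b ↦ a b` permutes the
residues mod `d`. [folklore] -/
theorem opP_opV_of_coprime (hG : Periodic G 1) {a d : ℕ} (hd : 0 < d) (had : Nat.Coprime a d) :
    opP d (opV a G) = opV a (opP d G) := by
  funext z
  simp only [opP, opV]
  congr 1
  have hdc : (d : ℂ) ≠ 0 := by exact_mod_cast hd.ne'
  have hterm : ∀ b : ℕ,
      G ((a : ℂ) * ((z + b) / d)) = G (((a : ℂ) * z + ((a * b % d : ℕ) : ℂ)) / d) := by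
    intro b
    have hdiv : a * b % d + d * (a * b / d) = a * b := Nat.mod_add_div _ _
    have hc : ((a * b % d : ℕ) : ℂ) + (d : ℂ) * ((a * b / d : ℕ) : ℂ) = (a : ℂ) * (b : ℂ) := by
      exact_mod_cast hdiv
    have : (a : ℂ) * ((z + b) / d) =
        ((a : ℂ) * z + ((a * b % d : ℕ) : ℂ)) / d + ((a * b / d : ℕ) : ℂ) := by
      field_simp
      linear_combination -hc
    rw [this]
    simpa using hG.nat_mul (a * b / d) (((a : ℂ) * z + ((a * b % d : ℕ) : ℂ)) / d)
  simp_rw [hterm]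
  have hinj : Set.InjOn (fun b : ℕ => a * b % d) (Finset.range d) := by
    intro b hb b' hb' h
    simp only [Finset.coe_range, Set.mem_Iio] at hb hb'
    have hmod : a * b ≡ a * b' [MOD d] := h
    exact (Nat.ModEq.cancel_left_of_coprime (by simpa [Nat.Coprime, Nat.gcd_comm] using had) hmod)
      |>.eq_of_lt_of_lt hb hb'
  rw [← Finset.sum_image (f := fun c : ℕ => G (((a : ℂ) * z + (c : ℂ)) / d)) hinj,
    image_mul_mod_range had]

/-- `U_1 = 1`. [folklore] -/
theorem opU_one (k : ℤ) (G : ℂ → ℂ) : opU k 1 G = G := by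
  funext z
  simp [opU, Nat.divisorsAntidiagonal_one]

/-- `U_p = Π_p + p^{k-1} V_p` for `p` prime. [cite: DiamondShurman2005, Prop. 5.2.1] -/
theorem opU_prime (k : ℤ) {p : ℕ} (hp : p.Prime) (G : ℂ → ℂ) :
    opU k p G = fun z => opP p G z + (p : ℂ) ^ (k - 1) * opV p G z := by
  funext z
  simp only [opU]
  rw [Nat.sum_divisorsAntidiagonal (f := fun a d => (a : ℂ) ^ (k - 1) * opV a (opP d G) z),
    hp.divisors, Finset.sum_pair hp.one_lt.ne, Nat.div_one, Nat.div_self hp.pos]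
  simp

/-- `U_{p^s} = ∑_{i ≤ s} p^{i(k-1)} V_{p^i} Π_{p^{s-i}}`. [cite: DiamondShurman2005, §5.3] -/
theorem opU_prime_pow (k : ℤ) {p : ℕ} (hp : p.Prime) (s : ℕ) (G : ℂ → ℂ) :
    opU k (p ^ s) G = fun z => ∑ i ∈ Finset.range (s + 1),
      ((p : ℂ) ^ i) ^ (k - 1) * opV (p ^ i) (opP (p ^ (s - i)) G) z := by
  funext z
  simp only [opU]
  rw [Nat.sum_divisorsAntidiagonal (f := fun a d => (a : ℂ) ^ (k - 1) * opV a (opP d G) z),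
    Nat.divisors_prime_pow hp, Finset.sum_map]
  refine Finset.sum_congr rfl fun i hi => ?_
  simp only [Function.Embedding.coeFn_mk, Nat.cast_pow]
  rw [Nat.pow_div (Nat.lt_succ_iff.mp (Finset.mem_range.mp hi)) hp.pos]

/-- The divisor pairs of `m n`, `(m, n) = 1`, are the products of the divisor pairs of `m` and of
`n` (the bijection behind `(f * g)(mn) = (f * g)(m) (f * g)(n)` for multiplicative `f, g`).
[folklore] -/
theorem sum_divisorsAntidiagonal_mul_of_coprime {M : Type*} [AddCommMonoid M] {m n : ℕ}
    (hmn : m.Coprime n) (f : ℕ → ℕ → M) :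
    ∑ w ∈ (m * n).divisorsAntidiagonal, f w.1 w.2 =
      ∑ x ∈ m.divisorsAntidiagonal, ∑ y ∈ n.divisorsAntidiagonal, f (x.1 * y.1) (x.2 * y.2) := by
  rw [← Finset.sum_product']
  symm
  apply Finset.sum_nbij fun ((i, j), k, l) ↦ (i * k, j * l)
  · rintro ⟨⟨a1, a2⟩, ⟨b1, b2⟩⟩ h
    simp only [Nat.mem_divisorsAntidiagonal, Ne, Finset.mem_product] at h
    rcases h with ⟨⟨rfl, ha⟩, ⟨rfl, hb⟩⟩
    simp only [Nat.mem_divisorsAntidiagonal, mul_eq_zero, Ne]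
    constructor
    · ring
    rw [mul_eq_zero] at *
    exact not_or_intro ha hb
  · simp only [Set.InjOn, Finset.mem_coe, Nat.mem_divisorsAntidiagonal, Finset.mem_product, Prod.mk_inj]
    rintro ⟨⟨a1, a2⟩, ⟨b1, b2⟩⟩ ⟨⟨rfl, ha⟩, ⟨rfl, hb⟩⟩ ⟨⟨c1, c2⟩, ⟨d1, d2⟩⟩ hcd h
    have cop := hmn
    ext
    · trans Nat.gcd (a1 * a2) (a1 * b1)
      · rw [Nat.gcd_mul_left, cop.coprime_mul_left.coprime_mul_right_right.gcd_eq_one, mul_one]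
      · rw [← hcd.1.1, ← hcd.2.1] at cop
        rw [← hcd.1.1, h.1, Nat.gcd_mul_left,
          cop.coprime_mul_left.coprime_mul_right_right.gcd_eq_one, mul_one]
    · trans Nat.gcd (a1 * a2) (a2 * b2)
      · rw [mul_comm, Nat.gcd_mul_left, cop.coprime_mul_right.coprime_mul_left_right.gcd_eq_one,
          mul_one]
      · rw [← hcd.1.1, ← hcd.2.1] at cop
        rw [← hcd.1.1, h.2, mul_comm, Nat.gcd_mul_left,
          cop.coprime_mul_right.coprime_mul_left_right.gcd_eq_one, mul_one]
    · trans Nat.gcd (b1 * b2) (a1 * b1)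
      · rw [mul_comm, Nat.gcd_mul_right,
          cop.coprime_mul_right.coprime_mul_left_right.symm.gcd_eq_one, one_mul]
      · rw [← hcd.1.1, ← hcd.2.1] at cop
        rw [← hcd.2.1, h.1, mul_comm c1 d1, Nat.gcd_mul_left,
          cop.coprime_mul_right.coprime_mul_left_right.symm.gcd_eq_one, mul_one]
    · trans Nat.gcd (b1 * b2) (a2 * b2)
      · rw [Nat.gcd_mul_right, cop.coprime_mul_left.coprime_mul_right_right.symm.gcd_eq_one, one_mul]
      · rw [← hcd.1.1, ← hcd.2.1] at cop
        rw [← hcd.2.1, h.2, Nat.gcd_mul_right,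
          cop.coprime_mul_left.coprime_mul_right_right.symm.gcd_eq_one, one_mul]
  · simp only [Set.SurjOn, Set.subset_def, Finset.mem_coe, Nat.mem_divisorsAntidiagonal,
      Finset.mem_product, Set.mem_image]
    rintro ⟨b1, b2⟩ h
    use ((b1.gcd m, b2.gcd m), (b1.gcd n, b2.gcd n))
    rw [← hmn.gcd_mul _, ← hmn.gcd_mul _, ← h.1, Nat.gcd_mul_gcd_of_coprime_of_mul_eq_mul hmn h.1,
      Nat.gcd_mul_gcd_of_coprime_of_mul_eq_mul hmn.symm _]
    · rw [Ne, mul_eq_zero, not_or] at h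
      simp [h.2.1, h.2.2]
    rw [mul_comm n m, h.1]
  · intro _ _
    rfl

/-- **`U_m U_n = U_{mn}` for `(m, n) = 1`** on `1`-periodic functions.
[cite: DiamondShurman2005, Prop. 5.2.4 and §5.3 (5.10)] -/
theorem opU_opU_of_coprime (hG : Periodic G 1) (k : ℤ) {m n : ℕ} (hm : m ≠ 0) (hn : n ≠ 0)
    (hmn : m.Coprime n) : opU k m (opU k n G) = opU k (m * n) G := by
  funext z
  -- expand the inner operator under `V_a Π_d`
  have hinner : ∀ x ∈ m.divisorsAntidiagonal,
      opV x.1 (opP x.2 (opU k n G)) z = ∑ y ∈ n.divisorsAntidiagonal,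
        (y.1 : ℂ) ^ (k - 1) * opV (x.1 * y.1) (opP (x.2 * y.2) G) z := by
    intro x hx
    obtain ⟨hx1, -⟩ := Nat.mem_divisorsAntidiagonal.mp hx
    have hx2 : 0 < x.2 := Nat.pos_of_ne_zero fun h => hm (by rw [← hx1, h, mul_zero])
    have hU : opU k n G = fun w => ∑ y ∈ n.divisorsAntidiagonal,
        (y.1 : ℂ) ^ (k - 1) * opV y.1 (opP y.2 G) w := rfl
    rw [hU, opP_sum, opV_sum]
    refine Finset.sum_congr rfl fun y hy => ?_
    obtain ⟨hy1, -⟩ := Nat.mem_divisorsAntidiagonal.mp hy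
    have hy2 : 0 < y.2 := Nat.pos_of_ne_zero fun h => hn (by rw [← hy1, h, mul_zero])
    have hcop : Nat.Coprime y.1 x.2 :=
      Nat.Coprime.of_dvd (Dvd.intro _ hy1) (Dvd.intro_left _ hx1) hmn.symm
    rw [opP_const_mul, opV_const_mul]
    simp only
    rw [opP_opV_of_coprime (periodic_opP hG hy2) hx2 hcop, opP_opP hx2 hy2, opV_opV]
  simp only [opU]
  rw [Finset.sum_congr rfl fun x hx => by rw [hinner x hx],
    sum_divisorsAntidiagonal_mul_of_coprime hmn
      (f := fun a d => (a : ℂ) ^ (k - 1) * opV a (opP d G) z)]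
  refine Finset.sum_congr rfl fun x _ => ?_
  rw [Finset.mul_sum]
  refine Finset.sum_congr rfl fun y _ => ?_
  rw [← mul_assoc, Nat.cast_mul, mul_zpow]

/-- **`U_p U_{p^{r+1}} = U_{p^{r+2}} + p^{k-1} U_{p^r}`** on `1`-periodic functions.
[cite: DiamondShurman2005, §5.3 (definition of T_{p^r}) and Prop. 5.3.1] -/
theorem opU_prime_opU_prime_pow (hG : Periodic G 1) (k : ℤ) {p : ℕ} (hp : p.Prime) (r : ℕ) :
    opU k p (opU k (p ^ (r + 1)) G) =
      fun z => opU k (p ^ (r + 2)) G z + (p : ℂ) ^ (k - 1) * opU k (p ^ r) G z := by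
  funext z
  have hp0 : 0 < p := hp.pos
  have hpc : (p : ℂ) ≠ 0 := by exact_mod_cast hp.ne_zero
  -- notation for the building blocks
  set X : ℕ → ℕ → ℂ := fun i j => opV (p ^ i) (opP (p ^ j) G) z with hX
  have hc : ∀ i : ℕ, ((p : ℂ) ^ (i + 1)) ^ (k - 1) = (p : ℂ) ^ (k - 1) * ((p : ℂ) ^ i) ^ (k - 1) := by
    intro i; rw [pow_succ, mul_zpow, mul_comm]
  rw [opU_prime k hp, opU_prime_pow k hp (r + 1), opU_prime_pow k hp (r + 2), opU_prime_pow k hp r]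
  simp only
  rw [opP_sum, opV_sum]
  simp only
  -- `Π_p`-part: the `i = 0` term is `Π_{p^{r+2}}`, the others drop one `V_p`
  have hP : ∀ i ∈ Finset.range (r + 2),
      opP p (fun w => ((p : ℂ) ^ i) ^ (k - 1) * opV (p ^ i) (opP (p ^ (r + 1 - i)) G) w) z =
        if i = 0 then X 0 (r + 2) else (p : ℂ) ^ (k - 1) * (((p : ℂ) ^ (i - 1)) ^ (k - 1) * X (i - 1) (r + 1 - i)) := by
    intro i hi
    rw [opP_const_mul]
    simp only
    rcases Nat.eq_zero_or_pos i with rfl | hi0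
    · simp only [if_true, pow_zero, one_zpow, one_mul, Nat.sub_zero, opV_one, hX]
      rw [opP_opP hp0 (pow_pos hp0 _), ← pow_succ']
    · rw [if_neg hi0.ne']
      obtain ⟨i, rfl⟩ := Nat.exists_eq_add_of_lt hi0
      simp only [zero_add, Nat.add_sub_cancel]
      rw [show p ^ (i + 1) = p * p ^ i by ring, ← opV_opV,
        opP_opV_self (periodic_opV (periodic_opP hG (pow_pos hp0 _)) _) hp0, hc i, hX]
      ring
  -- `V_p`-part: every term gains one `V_p`
  have hV : ∀ i ∈ Finset.range (r + 2),
      opV p (fun w => ((p : ℂ) ^ i) ^ (k - 1) * opV (p ^ i) (opP (p ^ (r + 1 - i)) G) w) z =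
        ((p : ℂ) ^ i) ^ (k - 1) * X (i + 1) (r + 1 - i) := by
    intro i _
    rw [opV_const_mul]
    simp only
    rw [opV_opV, ← pow_succ', hX]
  rw [Finset.sum_congr rfl hP, Finset.sum_congr rfl hV]
  -- reorganise the sums
  rw [Finset.sum_range_succ' (fun i => if i = 0 then X 0 (r + 2) else _) (r + 1)]
  simp only [Nat.succ_ne_zero, if_false, if_true, Nat.add_sub_cancel]
  rw [Finset.sum_range_succ' (fun j => ((p : ℂ) ^ j) ^ (k - 1) * X j (r + 2 - j)) (r + 2)]
  simp only [pow_zero, one_zpow, one_mul, Nat.sub_zero]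
  have h1 : ∀ i ∈ Finset.range (r + 2), ((p : ℂ) ^ (i + 1)) ^ (k - 1) * X (i + 1) (r + 2 - (i + 1)) =
      (p : ℂ) ^ (k - 1) * (((p : ℂ) ^ i) ^ (k - 1) * X (i + 1) (r + 1 - i)) := by
    intro i _
    rw [hc i, show r + 2 - (i + 1) = r + 1 - i by omega, mul_assoc]
  rw [Finset.sum_congr rfl h1]
  simp only [hX]
  rw [Finset.sum_congr rfl (g := fun x => (p : ℂ) ^ (k - 1) *
      (((p : ℂ) ^ x) ^ (k - 1) * opV (p ^ x) (opP (p ^ (r - x)) G) z)) fun x _ => by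
        rw [show r + 1 - (x + 1) = r - x by omega],
    ← Finset.mul_sum, ← Finset.mul_sum]
  ring

/-- **Locality**: `U_n G` on the upper half-plane only sees `G` on the upper half-plane. [folklore] -/
theorem opU_congr {G H : ℂ → ℂ} (h : ∀ z : ℂ, 0 < z.im → G z = H z) (k : ℤ) (n : ℕ) {z : ℂ}
    (hz : 0 < z.im) : opU k n G z = opU k n H z := by
  simp only [opU, opV, opP]
  refine Finset.sum_congr rfl fun x hx => ?_
  obtain ⟨hx1, hn⟩ := Nat.mem_divisorsAntidiagonal.mp hx
  have ha : 0 < x.1 := Nat.pos_of_ne_zero fun h0 => hn (by rw [← hx1, h0, zero_mul])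
  have hd : 0 < x.2 := Nat.pos_of_ne_zero fun h0 => hn (by rw [← hx1, h0, mul_zero])
  congr 2
  refine Finset.sum_congr rfl fun b _ => h _ ?_
  have : (((x.1 : ℂ) * z + b) / x.2).im = x.1 * z.im / x.2 := by
    rw [Complex.div_natCast_im]; simp
  rw [this]; positivity

end UpperHecke

/-! ### Upper-triangular integer matrices acting on `ℍ` and the slash action -/

section Upper

open UpperHecke Matrix

/-- The upper-triangular integer matrix `(a b; 0 d)`. [folklore] -/
def upperMat (a : ℕ) (b : ℤ) (d : ℕ) : Matrix (Fin 2) (Fin 2) ℤ := !![(a : ℤ), b; 0, (d : ℤ)]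

variable {a d : ℕ} (ha : 0 < a) (hd : 0 < d) (b : ℤ)

/-- `det (a b; 0 d) = a d`. [folklore] -/
theorem det_upperMat (a : ℕ) (b : ℤ) (d : ℕ) : (upperMat a b d).det = a * d := by
  simp [upperMat, Matrix.det_fin_two_of]

include ha hd in
/-- `det (a b; 0 d) ≠ 0`. [folklore] -/
theorem det_upperMat_ne_zero : (upperMat a b d).det ≠ 0 := by
  rw [det_upperMat]; positivity

include ha hd in
/-- The real matrix of `intGL (a b; 0 d)`. [folklore] -/
theorem val_intGL_upperMat :
    ((intGL (upperMat a b d) : GL (Fin 2) ℝ) : Matrix (Fin 2) (Fin 2) ℝ) = !![(a : ℝ), (b : ℝ); 0, (d : ℝ)] := by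
  rw [coe_intGL (det_upperMat_ne_zero ha hd b)]
  ext i j; fin_cases i <;> fin_cases j <;> simp [upperMat]

include ha hd in
/-- `det intGL (a b; 0 d) = a d`. [folklore] -/
theorem det_intGL_upperMat : (intGL (upperMat a b d)).det.val = (a : ℝ) * d := by
  simp [Matrix.GeneralLinearGroup.val_det_apply, val_intGL_upperMat ha hd, Matrix.det_fin_two_of]

include ha hd in
/-- `j((a b; 0 d), τ) = d`. [folklore] -/
theorem denom_intGL_upperMat (τ : ℍ) : denom (intGL (upperMat a b d)) τ = d := by
  simp [denom, val_intGL_upperMat ha hd]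

include ha hd in
/-- `(a b; 0 d) · τ = (a τ + b)/d`. [folklore] -/
theorem coe_intGL_upperMat_smul (τ : ℍ) :
    ((intGL (upperMat a b d) • τ : ℍ) : ℂ) = ((a : ℂ) * τ + b) / d := by
  have h : 0 < (intGL (upperMat a b d)).det.val := by rw [det_intGL_upperMat ha hd]; positivity
  rw [coe_smul_of_det_pos h, denom_intGL_upperMat ha hd]
  simp [num, val_intGL_upperMat ha hd]

include ha hd in
/-- **`(F |_k (a b; 0 d))(τ) = (ad)^{k-1} d^{-k} F((aτ + b)/d)`.**
[cite: DiamondShurman2005, (5.1) and Prop. 5.3.1] -/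
theorem slash_intGL_upperMat_apply (k : ℤ) (F : ℍ → ℂ) (τ : ℍ) :
    (F ∣[k] intGL (upperMat a b d)) τ =
      ((a : ℂ) * d) ^ (k - 1) * (d : ℂ) ^ (-k) * (F ∘ ofComplex) (((a : ℂ) * τ + b) / d) := by
  have hpos : 0 < (intGL (upperMat a b d)).det.val := by rw [det_intGL_upperMat ha hd]; positivity
  rw [ModularForm.slash_apply, σ_eq_self hpos, det_intGL_upperMat ha hd, denom_intGL_upperMat ha hd,
    abs_of_pos (by positivity : (0 : ℝ) < a * d), Function.comp_apply,
    ← coe_intGL_upperMat_smul ha hd b τ, ofComplex_apply]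
  push_cast
  ring

/-- **`∑_{0 ≤ b < d} (F |_k (a b; 0 d))(τ) = a^{k-1} (V_a Π_d (F ∘ ofComplex))(τ)`.** [folklore] -/
theorem sum_slash_intGL_upperMat_apply (k : ℤ) (F : ℍ → ℂ) {a d : ℕ} (ha : 0 < a) (hd : 0 < d) (τ : ℍ) :
    ∑ b ∈ Finset.range d, (F ∣[k] intGL (upperMat a (b : ℤ) d)) τ =
      (a : ℂ) ^ (k - 1) * opV a (opP d (F ∘ ofComplex)) τ := by
  have hdc : (d : ℂ) ≠ 0 := by exact_mod_cast hd.ne'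
  simp only [slash_intGL_upperMat_apply ha hd, opV, opP, Finset.mul_sum, Int.cast_natCast]
  refine Finset.sum_congr rfl fun b _ => ?_
  rw [mul_zpow, show ((a : ℂ) ^ (k - 1) * (d : ℂ) ^ (k - 1) * (d : ℂ) ^ (-k)) =
    (a : ℂ) ^ (k - 1) * (d : ℂ)⁻¹ by
      rw [mul_assoc, ← zpow_add₀ hdc, show k - 1 + -k = -1 by ring, _root_.zpow_neg_one]]
  ring

end Upper

/-! ### `T_n = U_n` on `S_k(Γ₀(N))` for `(n, N) = 1` -/

section Gamma0

open UpperHecke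

variable {N : ℕ} [NeZero N] {k : ℤ}

omit [NeZero N] in
/-- Cusp forms on `Γ₀(N)` are `1`-periodic: `f ∘ ofComplex` has period `1`. [folklore] -/
theorem periodic_coe_comp_ofComplex (f : CuspForm (Gamma0 N) k) : Periodic (⇑f ∘ ofComplex) 1 := by
  have hΓ : (1 : ℝ) ∈ (Gamma0 N : Subgroup (GL (Fin 2) ℝ)).strictPeriods := by
    rw [CongruenceSubgroup.strictPeriods_Gamma0]
    exact AddSubgroup.mem_zmultiples 1
  exact SlashInvariantFormClass.periodic_comp_ofComplex f hΓ

/-- `intGL (1 b; 0 p) = tpB p b`. [folklore] -/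
theorem intGL_upperMat_one (p : ℕ) [NeZero p] (b : ℕ) : intGL (upperMat 1 (b : ℤ) p) = tpB p (b : ℤ) := by
  ext i j
  rw [val_intGL_upperMat one_pos (NeZero.pos p), val_tpB]
  fin_cases i <;> fin_cases j <;> simp

/-- **`T_p = U_p` on `S_k(Γ₀(N))` for a prime `p ∤ N`** (Diamond–Shurman Prop. 5.2.1 in the
operator form `T_p = Π_p + p^{k-1} V_p`). [cite: DiamondShurman2005, Prop. 5.2.1] -/
theorem coe_heckeT_gamma0_eq_opU (p : ℕ) [NeZero p] (hp : p.Prime) (hpN : ¬ p ∣ N)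
    (f : CuspForm (Gamma0 N) k) (τ : ℍ) :
    (heckeT (Gamma0 N) k p f) τ = opU k p (⇑f ∘ ofComplex) τ := by
  rw [coe_heckeT_gamma0_eq_sum N k p hp f, if_neg hpN, opU_prime k hp]
  simp only [Pi.add_apply, Finset.sum_apply]
  congr 1
  · -- `∑_j f|(1 j; 0 p) = Π_p`
    have h := sum_slash_intGL_upperMat_apply k (⇑f) one_pos hp.pos τ
    simp only [Nat.cast_one, one_zpow, one_mul, opV, Nat.cast_one, one_mul] at h
    rw [← h, ← Finset.sum_range (fun b => (⇑f ∣[k] tpB p (b : ℤ)) τ)]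
    refine Finset.sum_congr rfl fun b _ => ?_
    rw [intGL_upperMat_one]
  · rw [slash_tpD_apply, opV, Function.comp_apply, ← coe_tpD_smul, ofComplex_apply]

omit [NeZero N] in
/-- `(T_n f) ∘ ofComplex = U_n (f ∘ ofComplex)` on the upper half-plane once it holds on `ℍ`.
[folklore] -/
theorem comp_ofComplex_eq_of_forall {g : CuspForm (Gamma0 N) k} {H : ℂ → ℂ}
    (h : ∀ τ : ℍ, g τ = H τ) (z : ℂ) (hz : 0 < z.im) : (⇑g ∘ ofComplex) z = H z := by
  rw [Function.comp_apply, ofComplex_apply_of_im_pos hz, h]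

/-- **`T_{p^e} = U_{p^e}` on `S_k(Γ₀(N))`, `p ∤ N`**, by the common recursion
`X_{p^{e+2}} = X_p X_{p^{e+1}} - p^{k-1} X_{p^e}`. [cite: DiamondShurman2005, §5.3] -/
theorem coe_heckeTnGamma0_prime_pow_eq_opU {p : ℕ} (hp : p.Prime) (hpN : ¬ p ∣ N) (e : ℕ)
    (f : CuspForm (Gamma0 N) k) (τ : ℍ) :
    (heckeTnGamma0 N k (p ^ e) f) τ = opU k (p ^ e) (⇑f ∘ ofComplex) τ := by
  haveI : NeZero p := ⟨hp.ne_zero⟩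
  induction e using Nat.twoStepInduction generalizing f τ with
  | zero =>
    rw [pow_zero, heckeTnGamma0_one, opU_one, Module.End.one_apply, Function.comp_apply,
      ofComplex_apply]
  | one => rw [pow_one, heckeTnGamma0_prime N k p hp, coe_heckeT_gamma0_eq_opU p hp hpN]
  | more e ih0 ih1 =>
    have hrec : heckeTnGamma0 N k (p ^ (e + 2)) f =
        heckeTnGamma0 N k p (heckeTnGamma0 N k (p ^ (e + 1)) f) -
          (p : ℂ) ^ (k - 1) • heckeTnGamma0 N k (p ^ e) f := by
      rw [heckeTnGamma0_prime_pow N k hp hpN e]; rfl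
    rw [hrec, CuspForm.sub_apply, CuspForm.IsGLPos.coe_smul, Pi.smul_apply, smul_eq_mul,
      heckeTnGamma0_prime N k p hp, coe_heckeT_gamma0_eq_opU p hp hpN, ih0,
      opU_congr (comp_ofComplex_eq_of_forall (ih1 f)) k p τ.im_pos,
      opU_prime_opU_prime_pow (periodic_coe_comp_ofComplex f) k hp e]
    ring

/-- **`T_n = U_n` on `S_k(Γ₀(N))` for `(n, N) = 1`**:
`(T_n f)(τ) = ∑_{ad = n} a^{k-1} d⁻¹ ∑_{0 ≤ b < d} f((aτ + b)/d)`
(Diamond–Shurman Prop. 5.3.1 / Shimura (3.5.10)). [cite: DiamondShurman2005, Prop. 5.3.1] -/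
theorem coe_heckeTnGamma0_eq_opU {n : ℕ} (hn0 : 0 < n) (hn : n.Coprime N)
    (f : CuspForm (Gamma0 N) k) (τ : ℍ) :
    (heckeTnGamma0 N k n f) τ = opU k n (⇑f ∘ ofComplex) τ := by
  induction n using Nat.recOnPosPrimePosCoprime generalizing f τ with
  | zero => exact absurd hn0 (lt_irrefl 0)
  | one => rw [heckeTnGamma0_one, opU_one, Module.End.one_apply, Function.comp_apply, ofComplex_apply]
  | prime_pow p e hp he =>
    have hpcop : p.Coprime N := Nat.Coprime.coprime_dvd_left (dvd_pow_self p he.ne') hn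
    have hpN : ¬ p ∣ N := fun h => hp.ne_one (Nat.Coprime.eq_one_of_dvd hpcop h)
    exact coe_heckeTnGamma0_prime_pow_eq_opU hp hpN e f τ
  | coprime a b ha hb hab iha ihb =>
    have haN : a.Coprime N := Nat.Coprime.coprime_mul_right hn
    have hbN : b.Coprime N := Nat.Coprime.coprime_mul_left hn
    rw [heckeTnGamma0_mul_of_coprime N k (by omega) (by omega) hab, Module.End.mul_apply,
      iha (by omega) haN, opU_congr (comp_ofComplex_eq_of_forall (ihb (by omega) hbN f)) k a τ.im_pos,
      opU_opU_of_coprime (periodic_coe_comp_ofComplex f) k (by omega) (by omega) hab]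

/-! ### `T_n f` as the sum of slashes over `R_n`, and its modular symbols -/

open Literature.NumberTheory.Automorphic.PopaZagier in
/-- The Hermite representatives `R_n` of `PopaZagierHeckeCompatibility` are the matrices
`(a b; 0 d)`, `ad = n`, `0 ≤ b < d`: reindexing a sum over `R_n` by `((a, d), b)`. [folklore] -/
theorem sum_hermiteReps_eq {M : Type*} [AddCommMonoid M] {n : ℕ} (hn : 0 < n)
    (g : Matrix (Fin 2) (Fin 2) ℤ → M) :
    ∑ C ∈ hermiteReps (n : ℤ), g C =
      ∑ x ∈ n.divisorsAntidiagonal, ∑ b ∈ Finset.range x.2, g (upperMat x.1 (b : ℤ) x.2) := by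
  classical
  set S : Finset ((ℕ × ℕ) × ℕ) := (n.divisorsAntidiagonal ×ˢ Finset.range n).filter
    fun y => y.2 < y.1.2 with hS
  set φ : (ℕ × ℕ) × ℕ → Matrix (Fin 2) (Fin 2) ℤ := fun y => upperMat y.1.1 (y.2 : ℤ) y.1.2 with hφ
  have hn' : (0 : ℤ) < n := by exact_mod_cast hn
  -- `R_n = φ(S)`
  have himage : hermiteReps (n : ℤ) = S.image φ := by
    ext C
    rw [mem_hermiteReps hn', Finset.mem_image]
    constructor
    · rintro ⟨hc, ha, hb0, hbd, hdet⟩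
      have had : C 0 0 * C 1 1 = n := by rw [← hdet, Matrix.det_fin_two, hc]; ring
      have hd : 0 < C 1 1 := by omega
      refine ⟨⟨⟨(C 0 0).toNat, (C 1 1).toNat⟩, (C 0 1).toNat⟩, ?_, ?_⟩
      · simp only [hS, Finset.mem_filter, Finset.mem_product, Nat.mem_divisorsAntidiagonal,
          Finset.mem_range]
        refine ⟨⟨⟨?_, hn.ne'⟩, ?_⟩, ?_⟩
        · zify; rw [Int.toNat_of_nonneg ha.le, Int.toNat_of_nonneg hd.le, had]
        · zify; rw [Int.toNat_of_nonneg hb0]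
          have : C 1 1 ≤ n := by nlinarith
          omega
        · zify; rw [Int.toNat_of_nonneg hb0, Int.toNat_of_nonneg hd.le]; exact hbd
      · simp only [hφ, upperMat]
        rw [Int.toNat_of_nonneg ha.le, Int.toNat_of_nonneg hd.le, Int.toNat_of_nonneg hb0]
        ext i j; fin_cases i <;> fin_cases j <;> simp [hc]
    · rintro ⟨⟨⟨a, d⟩, b⟩, hy, rfl⟩
      simp only [hS, Finset.mem_filter, Finset.mem_product, Nat.mem_divisorsAntidiagonal,
        Finset.mem_range] at hy
      obtain ⟨⟨⟨had, -⟩, -⟩, hbd⟩ := hy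
      have ha : 0 < a := Nat.pos_of_ne_zero fun h => hn.ne' (by rw [← had, h, zero_mul])
      have hd : 0 < d := Nat.pos_of_ne_zero fun h => hn.ne' (by rw [← had, h, mul_zero])
      refine ⟨by simp [hφ, upperMat], by simpa [hφ, upperMat] using ha, by simp [hφ, upperMat],
        by simpa [hφ, upperMat] using hbd, ?_⟩
      rw [hφ]
      simp only
      rw [det_upperMat]; exact_mod_cast had
  -- `φ` is injective on `S`
  have hinj : Set.InjOn φ S := by
    rintro ⟨⟨a, d⟩, b⟩ - ⟨⟨a', d'⟩, b'⟩ - h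
    simp only [hφ, upperMat] at h
    have h00 := congrFun (congrFun h 0) 0
    have h01 := congrFun (congrFun h 0) 1
    have h11 := congrFun (congrFun h 1) 1
    simp only [Matrix.of_apply, Matrix.cons_val', Matrix.cons_val_zero, Matrix.cons_val_one,
      Matrix.cons_val_fin_one, Nat.cast_inj] at h00 h01 h11
    simp [h00, h01, h11]
  rw [himage, Finset.sum_image hinj, hS, Finset.sum_filter, Finset.sum_product]
  refine Finset.sum_congr rfl fun x hx => ?_
  obtain ⟨hx1, -⟩ := Nat.mem_divisorsAntidiagonal.mp hx
  have hxn : x.2 ≤ n := Nat.le_of_dvd hn (Dvd.intro_left _ hx1)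
  rw [← Finset.sum_filter, show (Finset.range n).filter (fun b => b < x.2) = Finset.range x.2 by
    ext b; simp only [Finset.mem_filter, Finset.mem_range]; omega]

open Literature.NumberTheory.Automorphic.PopaZagier in
/-- **`T_n f = ∑_{C ∈ R_n} f |_k C` on `S_k(Γ₀(N))` for `(n, N) = 1`**, `R_n = {(a b; 0 d) : ad = n,
0 ≤ b < d}` (Diamond–Shurman Prop. 5.3.1 / Shimura Prop. 3.36: `R_n` represents
`Γ₀(N) \ Δ₀ᴺ(n)`). [cite: DiamondShurman2005, Prop. 5.3.1] -/
theorem coe_heckeTnGamma0_eq_sum_slash {n : ℕ} (hn0 : 0 < n) (hn : n.Coprime N)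
    (f : CuspForm (Gamma0 N) k) :
    ⇑(heckeTnGamma0 N k n f) = ∑ C ∈ hermiteReps (n : ℤ), ⇑f ∣[k] intGL C := by
  funext τ
  rw [coe_heckeTnGamma0_eq_opU hn0 hn f τ, Finset.sum_apply, sum_hermiteReps_eq hn0, opU]
  refine Finset.sum_congr rfl fun x hx => ?_
  obtain ⟨hx1, -⟩ := Nat.mem_divisorsAntidiagonal.mp hx
  have ha : 0 < x.1 := Nat.pos_of_ne_zero fun h => hn0.ne' (by rw [← hx1, h, zero_mul])
  have hd : 0 < x.2 := Nat.pos_of_ne_zero fun h => hn0.ne' (by rw [← hx1, h, mul_zero])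
  exact (sum_slash_intGL_upperMat_apply k (⇑f) ha hd τ).symm

open MeasureTheory Set in
/-- **Modular symbols of `T_n f`** for `(n, N) = 1`:
`{∞, r}_{T_n f} = ∑_{ad = n} ∑_{0 ≤ b < d} {∞, (a r + b)/d}_f` (Cremona (2.4.1)–(2.4.2): the affine
maps `z ↦ (az + b)/d` fix `∞`). [cite: CremonaAlgorithms1997, §2.4 (2.4.1)–(2.4.2)] -/
theorem modularSymbol_heckeTnGamma0 {n : ℕ} (hn0 : 0 < n) (hn : n.Coprime N)
    (f : CuspForm (Gamma0 N) 2) (r : ℚ) :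
    modularSymbol (heckeTnGamma0 N 2 n f) r =
      ∑ x ∈ n.divisorsAntidiagonal, ∑ b ∈ Finset.range x.2,
        modularSymbol f ((x.1 * r + b) / x.2) := by
  -- the pieces of the integrand and their integrability
  set F : ℕ × ℕ → ℕ → ℝ → ℂ :=
    fun x b s => f (ofComplex ((((x.1 * r + b) / x.2 : ℚ) : ℂ) + s * I)) with hF
  have hint : ∀ x b, IntegrableOn (F x b) (Ioi 0) := fun x b =>
    integrableOn_modularSymbol_integrand_holds f _
  have hpos : ∀ x ∈ n.divisorsAntidiagonal, 0 < x.1 ∧ 0 < x.2 := by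
    intro x hx
    obtain ⟨hx1, -⟩ := Nat.mem_divisorsAntidiagonal.mp hx
    exact ⟨Nat.pos_of_ne_zero fun h => hn0.ne' (by rw [← hx1, h, zero_mul]),
      Nat.pos_of_ne_zero fun h => hn0.ne' (by rw [← hx1, h, mul_zero])⟩
  have hint' : ∀ x ∈ n.divisorsAntidiagonal, ∀ b,
      IntegrableOn (fun t : ℝ => F x b ((x.1 : ℝ) / x.2 * t)) (Ioi 0) := by
    intro x hx b
    have hc : 0 < (x.1 : ℝ) / x.2 := by
      have := hpos x hx; exact div_pos (by exact_mod_cast this.1) (by exact_mod_cast this.2)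
    exact (integrableOn_Ioi_comp_mul_left_iff (F x b) 0 hc).mpr (by simpa using hint x b)
  -- the integrand of `{∞, r}_{T_n f}`
  have hI : ∀ t ∈ Ioi (0 : ℝ), (heckeTnGamma0 N 2 n f) (ofComplex ((r : ℂ) + t * I)) =
      ∑ x ∈ n.divisorsAntidiagonal, ∑ b ∈ Finset.range x.2,
        ((x.1 : ℂ) * (x.2 : ℂ)⁻¹) * F x b ((x.1 : ℝ) / x.2 * t) := by
    intro t ht
    have him : 0 < ((r : ℂ) + t * I).im := by simpa using ht
    rw [coe_heckeTnGamma0_eq_opU hn0 hn f, ofComplex_apply_of_im_pos him]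
    change opU 2 n (⇑f ∘ ofComplex) ((r : ℂ) + t * I) = _
    simp only [opU, opV, opP, Finset.mul_sum, Function.comp_apply]
    refine Finset.sum_congr rfl fun x hx => Finset.sum_congr rfl fun b _ => ?_
    obtain ⟨ha, hd⟩ := hpos x hx
    have hdc : (x.2 : ℂ) ≠ 0 := by exact_mod_cast hd.ne'
    rw [show (2 : ℤ) - 1 = 1 by norm_num, zpow_one, ← mul_assoc, hF]
    simp only
    congr 3
    push_cast
    field_simp
    ring
  -- integrate term by term and substitute `s = (a/d) t`
  rw [modularSymbol, setIntegral_congr_fun measurableSet_Ioi hI,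
    integral_finsetSum _ (fun x hx => integrable_finsetSum _ fun b _ => (hint' x hx b).const_mul _),
    Finset.mul_sum]
  refine Finset.sum_congr rfl fun x hx => ?_
  obtain ⟨ha, hd⟩ := hpos x hx
  have hc : 0 < (x.1 : ℝ) / x.2 := div_pos (by exact_mod_cast ha) (by exact_mod_cast hd)
  rw [integral_finsetSum _ (fun b _ => (hint' x hx b).const_mul _), Finset.mul_sum]
  refine Finset.sum_congr rfl fun b _ => ?_
  rw [integral_const_mul, integral_comp_mul_left_Ioi (F x b) 0 hc, mul_zero, Complex.real_smul,
    modularSymbol]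
  have h1 : ((x.1 : ℂ) * (x.2 : ℂ)⁻¹) * ((((x.1 : ℝ) / x.2)⁻¹ : ℝ) : ℂ) = 1 := by
    have hac : (x.1 : ℂ) ≠ 0 := by exact_mod_cast ha.ne'
    have hdc : (x.2 : ℂ) ≠ 0 := by exact_mod_cast hd.ne'
    push_cast
    field_simp
  rw [← mul_assoc ((x.1 : ℂ) * (x.2 : ℂ)⁻¹), h1, one_mul]

end Gamma0


end Literature.NumberTheory.EllipticCurves.ModularForms
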